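import Summits.CriticalPhenomena.Ising3DConformalLimit.Theorems.InverseSquareTelemetryPositiveSolutionAsymptoticsAprioriBounds
import HarnessLib

/-!
# Crux `PositiveSolutionAsymptotics` (stmt-CriticalPhenomena-4496), stub `stub_shellMonotone` (T1):
# shell monotonicity of `q = u |x|₂^{α₊}` for positive solutions of `Δ_{ℤ³} u = V u` far out

THEOREM-ONLY file (no definitions, no named facts), `--supports stmt-CriticalPhenomena-4496`.

Let `u, V : ℤ³ → ℝ`, `R`, `κ ≥ 0`, `ε > 0`, `C` with, on `{|x|₂ ≥ R}` (`|x|₂ = √s`, `s = ∑ᵢ xᵢ²`):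
`u > 0`, `Δ_{ℤ³} u = V u` (six-neighbour Laplacian, inlined) and `|s V - κ| ≤ C √s^{-ε}`; and `u → 0`
cofinitely. Put `p = (1 + √(1+4κ))/4` (`2p = α₊(κ)`), `q = u √s^{α₊} = u s^p`.

`stub_shellMonotone` (registered stub T1, verbatim): there are `S₀` and `η(S) = 2A(S/4)^{-e'} → 0`,
`0 ≤ η ≤ 1/2` on `[S₀, ∞)`, such that for `S ≥ S₀`, `K ≥ 0`: `q ≤ K` on the shell `{S/4 ≤ s < S}`
implies `q ≤ (1 + η(S)) K` on `E_S = {S ≤ s}`, and `K ≤ q` on the shell implies `(1 - η(S)) K ≤ q` on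
`E_S`. Proof: `exterior_comparison` (file `…AprioriBounds`) gives `S₀ ≥ 64`, `A > 0`, `e' > 0` and, for
every `T ≥ S₀`, the comparison of `u` with the barriers `K' (s^{-p} ∓ A s^{-(p+e')})` on `E_T` from its
lattice boundary `∂E_T ⊆ {T/4 ≤ s < T}` (`sumSq_of_mem_zdOuterBoundary`). With `a = A (T/4)^{-e'}`
(`≥ A s^{-e'}` on the shell, `Real.rpow_le_rpow_of_nonpos`) and `K' = K/(1 - a)` (resp. `k = K/(1 + a)`):
`q ≤ K` on the shell gives `u ≤ K' w₊` on `∂E_T`, hence on `E_T`, hence `q ≤ K' ≤ (1 + 2a) K`; and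
`K ≤ q` on the shell gives `k w₋ ≤ u` on `∂E_T`, hence on `E_T`, hence `q ≥ k ≥ (1 - 2a) K`. The
threshold is enlarged to `max S₀ S₁` so that `η = 2a ≤ 1/2` (`η → 0`, `tendsto_rpow_neg_atTop`).

References: Murata, Duke Math. J. 53 (1986); Pinchover, J. Differential Equations 111 (1994);
Keller–Pinchover–Pogorzelski, J. Spectral Theory 10 (2020) §4.2 (positive solutions on graphs).
-/

noncomputable section

namespace Summit.CriticalPhenomena.Ising3DConformalLimit.Theorems.PositiveSolutionAsymptotics

open Literature.Probability.LatticeModels Finset Set Filter Topology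
open Summit.CriticalPhenomena.Ising3DConformalLimit.Theorems.EtaBoundsFromTelemetry

/-- **T1 (shell monotonicity; exterior comparison with pure-power normalisation).** Under the
hypotheses of the crux there are a threshold `S₀` and a rate `η(S) → 0` such that for every
`S ≥ S₀`: if `q ≤ K` (resp. `q ≥ K ≥ 0`) on the shell `{S/4 ≤ s < S}` (which contains the lattice
boundary of the exterior region `E_S = {s ≥ S}`), then `q ≤ (1 + η(S)) K` (resp. `q ≥ (1 - η(S)) K`) on
all of `E_S` (`s = ∑ xᵢ² = |x|₂²`, `q = u |x|₂^{α₊}`). Proof: the barriers `s^{-p} ∓ A s^{-p-e'}` and the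
`h`-transform maximum principle on `E_S` with the non-decaying weight `h = 1 + s^{-e'}` (decay
hypothesis = `u → 0`), `η(S) = 2A(S/4)^{-e'}`. Consequence used by the lead: shell maxima of `q` are
almost decreasing and shell minima almost increasing in `S`, hence converge. Size M (given S1's file). -/
theorem stub_shellMonotone :
    ∀ κ ε C : ℝ, 0 ≤ κ → 0 < ε → ∀ (u V : Literature.Probability.LatticeModels.Site 3 → ℝ) (R : ℝ), (∀ x : Literature.Probability.LatticeModels.Site 3, R ≤ Real.sqrt (∑ i, ((x i : ℝ)) ^ 2) → 0 < u x) → (∀ x : Literature.Probability.LatticeModels.Site 3, R ≤ Real.sqrt (∑ i, ((x i : ℝ)) ^ 2) → (∑ i : Fin 3, (u (x + Pi.single i 1) + u (x - Pi.single i 1))) - 6 * u x = V x * u x) → (∀ x : Literature.Probability.LatticeModels.Site 3, R ≤ Real.sqrt (∑ i, ((x i : ℝ)) ^ 2) → |(∑ i, ((x i : ℝ)) ^ 2) * V x - κ| ≤ C * Real.sqrt (∑ i, ((x i : ℝ)) ^ 2) ^ (-ε)) → Filter.Tendsto u Filter.cofinite (nhds 0) → ∃ (S₀ : ℝ) (η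 : ℝ → ℝ), Filter.Tendsto η Filter.atTop (nhds 0) ∧ (∀ S : ℝ, S₀ ≤ S → 0 ≤ η S ∧ η S ≤ 1 / 2) ∧ ∀ S K : ℝ, S₀ ≤ S → 0 ≤ K → ((∀ y : Literature.Probability.LatticeModels.Site 3, S / 4 ≤ (∑ i, ((y i : ℝ)) ^ 2) → (∑ i, ((y i : ℝ)) ^ 2) < S → u y * Real.sqrt (∑ i, ((y i : ℝ)) ^ 2) ^ ((1 + Real.sqrt (1 + 4 * κ)) / 2) ≤ K) → ∀ x : Literature.Probability.LatticeModels.Site 3, S ≤ (∑ i, ((x i : ℝ)) ^ 2) → u x * Real.sqrt (∑ i, ((x i : ℝ)) ^ 2) ^ ((1 + Real.sqrt (1 + 4 * κ)) / 2) ≤ (1 + η S) * K) ∧ ((∀ y : Literature.Probability.LatticeModels.Site 3, S / 4 ≤ (∑ i, ((y i : ℝ)) ^ 2) → (∑ i, ((y i : ℝ)) ^ 2) < S → K ≤ u y * Real.sqrt (∑ i, ((y i : ℝ)) ^ 2) ^ ((1 + Real.sqrt (1 + 4 * κ)) / 2)) → ∀ x : Literature.Probability.LatticeModels.Site 3, S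 ≤ (∑ i, ((x i : ℝ)) ^ 2) → (1 - η S) * K ≤ u x * Real.sqrt (∑ i, ((x i : ℝ)) ^ 2) ^ ((1 + Real.sqrt (1 + 4 * κ)) / 2)) := by
  intro κ ε C hκ hε u V R hupos heq hVT hu0
  obtain ⟨S₀, A, e', hA0, he'0, hS₀64, -, hcomp⟩ := exterior_comparison hκ hε hupos heq hVT hu0
  -- the rate `η(S) = 2 A (S/4)^{-e'} → 0`, and a threshold `S₁` beyond which `η ≤ 1/2`
  obtain ⟨η, hη⟩ : ∃ η : ℝ → ℝ, ∀ S, η S = 2 * (A * (S / 4) ^ (-e')) := ⟨_, fun _ => rfl⟩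
  have hηt : Tendsto η atTop (𝓝 0) := by
    have h := (((tendsto_rpow_neg_atTop he'0).comp
      (tendsto_id.atTop_div_const (by norm_num : (0 : ℝ) < 4))).const_mul A).const_mul 2
    simp only [mul_zero] at h
    exact h.congr fun S => (hη S).symm
  obtain ⟨S₁, hS₁⟩ := Filter.eventually_atTop.1
    (hηt.eventually (eventually_le_nhds (show (0 : ℝ) < 1 / 2 by norm_num)))
  refine ⟨max S₀ S₁, η, hηt, fun S hS => ⟨?_, hS₁ S ((le_max_right _ _).trans hS)⟩,
    fun T K hT hK => ?_⟩
  · rw [hη]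
    have hS4 : 0 ≤ S / 4 := by linarith [le_max_left S₀ S₁]
    exact mul_nonneg zero_le_two (mul_nonneg hA0.le (Real.rpow_nonneg hS4 _))
  have hT₀ : S₀ ≤ T := (le_max_left _ _).trans hT
  have hηT : η T ≤ 1 / 2 := hS₁ T ((le_max_right _ _).trans hT)
  obtain ⟨-, hb, hc⟩ := hcomp T hT₀
  -- abbreviate `s = ∑ xᵢ²`, normalise `√s ^ (2p) = s ^ p`
  obtain ⟨s, hs⟩ : ∃ s : Site 3 → ℝ, ∀ x, s x = ∑ i, ((x i : ℤ) : ℝ) ^ 2 := ⟨_, fun _ => rfl⟩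
  have hbdry : ∀ y ∈ zdOuterBoundary {x : Site 3 | T ≤ ∑ i, ((x i : ℤ) : ℝ) ^ 2},
      T / 4 ≤ s y ∧ s y < T := fun y hy => by
    have h := sumSq_of_mem_zdOuterBoundary (hS₀64.trans hT₀) hy
    rwa [← hs] at h
  simp only [← hs] at hb hc hbdry ⊢
  have hs0 : ∀ x, 0 ≤ s x := fun x => by rw [hs]; positivity
  have hexp : ∀ x, Real.sqrt (s x) ^ ((1 + Real.sqrt (1 + 4 * κ)) / 2) =
      s x ^ ((1 + Real.sqrt (1 + 4 * κ)) / 4) := fun x => by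
    rw [Real.sqrt_eq_rpow (s x), ← Real.rpow_mul (hs0 x)]; congr 1; ring
  simp only [hexp]
  generalize (1 + Real.sqrt (1 + 4 * κ)) / 4 = p at hb hc ⊢
  -- `a = A (T/4)^{-e'}`: `η T = 2a ≤ 1/2`, and `A s^{-e'} ≤ a` for `s ≥ T/4`
  obtain ⟨a, ha⟩ : ∃ a : ℝ, a = A * (T / 4) ^ (-e') := ⟨_, rfl⟩
  have hηa : η T = 2 * a := by rw [hη, ha]
  have hT16 : 16 ≤ T / 4 := by linarith
  have ha0 : 0 ≤ a := by rw [ha]; exact mul_nonneg hA0.le (Real.rpow_nonneg (by linarith) _)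
  have ha4 : a ≤ 1 / 4 := by linarith
  have hmono : ∀ y : Site 3, T / 4 ≤ s y → A * s y ^ (-e') ≤ a := fun y hy => by
    rw [ha]
    exact mul_le_mul_of_nonneg_left
      (Real.rpow_le_rpow_of_nonpos (by linarith) hy (by linarith)) hA0.le
  have hsplit : ∀ y : Site 3, T / 4 ≤ s y → s y ^ (-(p + e')) = s y ^ (-e') * s y ^ (-p) :=
    fun y hy => by
    rw [← Real.rpow_add (by linarith : 0 < s y)]; congr 1; ring
  rw [hηa]
  constructor
  · -- upper clause: `u ≤ K/(1-a) · w₊` on `∂E_T`, hence on `E_T`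
    intro hKsh x hx
    have h1a : 0 < 1 - a := by linarith
    have hKb : ∀ y ∈ zdOuterBoundary {x : Site 3 | T ≤ s x},
        u y ≤ K / (1 - a) * (s y ^ (-p) - A * s y ^ (-(p + e'))) := by
      intro y hy
      obtain ⟨hy4, hyT⟩ := hbdry y hy
      have hsy : 0 < s y := by linarith
      have hw : 0 < s y ^ (-p) := Real.rpow_pos_of_pos hsy _
      have huK : u y ≤ K * s y ^ (-p) := by
        rw [Real.rpow_neg hsy.le, ← div_eq_mul_inv, le_div_iff₀ (Real.rpow_pos_of_pos hsy _)]
        exact hKsh y hy4 hyT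
      have hnn : 0 ≤ K * s y ^ (-p) * (a - A * s y ^ (-e')) :=
        mul_nonneg (mul_nonneg hK hw.le) (by linarith [hmono y hy4])
      rw [hsplit y hy4]
      refine huK.trans ?_
      rw [div_mul_eq_mul_div, le_div_iff₀ h1a]
      linarith
    have hux := hb (K / (1 - a)) (div_nonneg hK h1a.le) hKb x hx
    have hsx : 0 < s x := by linarith
    have hAx : 0 ≤ K / (1 - a) * (A * s x ^ (-(p + e'))) :=
      mul_nonneg (div_nonneg hK h1a.le) (mul_nonneg hA0.le (Real.rpow_nonneg hsx.le _))
    have hux' : u x ≤ K / (1 - a) * s x ^ (-p) := by linarith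
    rw [Real.rpow_neg hsx.le, ← div_eq_mul_inv, le_div_iff₀ (Real.rpow_pos_of_pos hsx _)] at hux'
    have hfin : K / (1 - a) ≤ (1 + 2 * a) * K := by
      rw [div_le_iff₀ h1a]
      have : 0 ≤ K * a * (1 - 2 * a) := mul_nonneg (mul_nonneg hK ha0) (by linarith)
      linarith
    exact hux'.trans hfin
  · -- lower clause: `K/(1+a) · w₋ ≤ u` on `∂E_T`, hence on `E_T`
    intro hKsh x hx
    have h1a : 0 < 1 + a := by linarith
    have hkb : ∀ y ∈ zdOuterBoundary {x : Site 3 | T ≤ s x},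
        K / (1 + a) * (s y ^ (-p) + A * s y ^ (-(p + e'))) ≤ u y := by
      intro y hy
      obtain ⟨hy4, hyT⟩ := hbdry y hy
      have hsy : 0 < s y := by linarith
      have hw : 0 < s y ^ (-p) := Real.rpow_pos_of_pos hsy _
      have hKu : K * s y ^ (-p) ≤ u y := by
        rw [Real.rpow_neg hsy.le, ← div_eq_mul_inv, div_le_iff₀ (Real.rpow_pos_of_pos hsy _)]
        exact hKsh y hy4 hyT
      have hnn : 0 ≤ K * s y ^ (-p) * (a - A * s y ^ (-e')) :=
        mul_nonneg (mul_nonneg hK hw.le) (by linarith [hmono y hy4])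
      have h2 : K * s y ^ (-p) * (1 + a) ≤ u y * (1 + a) :=
        mul_le_mul_of_nonneg_right hKu h1a.le
      rw [hsplit y hy4, div_mul_eq_mul_div, div_le_iff₀ h1a]
      linarith
    have hux := hc (K / (1 + a)) (div_nonneg hK h1a.le) hkb x hx
    have hsx : 0 < s x := by linarith
    have hAx : 0 ≤ K / (1 + a) * (A * s x ^ (-(p + e'))) :=
      mul_nonneg (div_nonneg hK h1a.le) (mul_nonneg hA0.le (Real.rpow_nonneg hsx.le _))
    have hux' : K / (1 + a) * s x ^ (-p) ≤ u x := by linarith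
    rw [Real.rpow_neg hsx.le, ← div_eq_mul_inv, div_le_iff₀ (Real.rpow_pos_of_pos hsx _)] at hux'
    have hfin : (1 - 2 * a) * K ≤ K / (1 + a) := by
      rw [le_div_iff₀ h1a]
      have : 0 ≤ K * a * (1 + 2 * a) := mul_nonneg (mul_nonneg hK ha0) (by linarith)
      linarith
    exact hfin.trans hux'

end Summit.CriticalPhenomena.Ising3DConformalLimit.Theorems.PositiveSolutionAsymptotics
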